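import Literature.NumberTheory.DiophantineGeometry.SchurWeylPlethysmOrbitWeightsProofs
import Literature.Computability.AlgebraicComplexity.ValiantConjectureProofs

/-!
# Route GeneratorObstructions — piece K1 `PerGenDegreeSuperQP`, line `per-side-atoms`, stub `stub_atomGen`

Crux item `stmt-ValiantsHypothesis-11654` (`GeneratorObstructions.PerGenDegreeSuperQP`, binder K1 of the
route's `closes` after the A2 split applied by the tenure sweep 2026-08-27), registered line
`Cruxes/GenFlipThesis/Lines/per_side_atoms.lean` (crux-strategist BC3, skeleton stubs `stub_atomLate`
[conjecture-grade, the content] and `stub_atomGen` [provable now, S]). This file proves `stub_atomGen`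
VERBATIM (route-independent: Literature imports only):

> for `1 ≤ m` and a weight `χ` OCCURRING in the coordinate ring `ℂ[Δ_m[per_m]]` of the orbit closure
> of `per_m` (in its own `m²` lexicographically ordered variables) which is an ATOM of the occurrence
> monoid — every splitting `χ = χ₁ + χ₂` into nonzero weights has a non-occurring summand — the
> generator count `γ_χ = dim (HWV_χ ⧸ (HWV_χ ∩ Σ_{χ₁+χ₂=χ, χᵢ≠0} HWV_χ₁ · HWV_χ₂))` is nonzero.

Proof: at an atom every summand `HWV_χ₁ · HWV_χ₂` of the decomposable part has a `⊥` factor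
(`Submodule.mul_bot` / `Submodule.bot_mul`), so the decomposable part is `⊥`, its pull-back to `HWV_χ`
is `⊥`, and the quotient is `HWV_χ` itself — finite-dimensional for `m ≠ 0`
(`finiteDimensional_highestWeightSpace_orbitCoordRep_holds`, BLMW 2011 §5.2) and nonzero by the
occurrence hypothesis, hence of positive dimension.

With it the line's composition `PerGenDegreeSuperQP_of` is closed modulo the single bet `stub_atomLate`
(late atoms of the permanent's occurrence monoid). Honest framing: bookkeeping about highest-weight
vectors; K1, its parent `GenFlipThesis` and `stub_atomLate` remain OPEN; nothing here bears on `VP ≠ VNP`.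
-/

-- Sub = Summit layout duplicates the namespace component
set_option linter.dupNamespace false

noncomputable section

namespace Summit.ValiantsHypothesis.ValiantsHypothesis.Theorems.GeneratorObstructions.PerGenDegreeSuperQP

open Literature.NumberTheory.DiophantineGeometry Literature.Computability.AlgebraicComplexity

/-- **Atoms of the occurrence monoid are generator types** (stub `stub_atomGen` of line `per-side-atoms`,
registered signature verbatim): for `1 ≤ m`, an occurring weight `χ` of `ℂ[Δ_m[per_m]]` with no splitting
into two nonzero occurring weights has nonzero generator count
`dim (HWV_χ ⧸ HWV_χ ∩ Σ HWV_χ₁ · HWV_χ₂) ≠ 0` — the decomposable part vanishes factor by factor, and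
`HWV_χ ≠ ⊥` is finite-dimensional (BLMW 2011 §5.2). -/
theorem stub_atomGen :
    ∀ m : ℕ, 1 ≤ m → ∀ χ : Weight (MatIdx m), highestWeightSpace (orbitCoordRep (MvPolynomial.rename toLex (perPoly (Fin m) ℂ)) m) χ ≠ ⊥ →
      (∀ χ₁ χ₂ : Weight (MatIdx m), χ₁ + χ₂ = χ → χ₁ ≠ 0 → χ₂ ≠ 0 →
          highestWeightSpace (orbitCoordRep (MvPolynomial.rename toLex (perPoly (Fin m) ℂ)) m) χ₁ = ⊥ ∨ highestWeightSpace (orbitCoordRep (MvPolynomial.rename toLex (perPoly (Fin m) ℂ)) m) χ₂ = ⊥) →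
      Module.finrank ℂ (↥(highestWeightSpace (orbitCoordRep (MvPolynomial.rename toLex (perPoly (Fin m) ℂ)) m) (χ)) ⧸ Submodule.comap (highestWeightSpace (orbitCoordRep (MvPolynomial.rename toLex (perPoly (Fin m) ℂ)) m) (χ)).subtype (⨆ p : Weight (MatIdx (m)) × Weight (MatIdx (m)), ⨆ (_ : p.1 + p.2 = (χ) ∧ p.1 ≠ 0 ∧ p.2 ≠ 0), highestWeightSpace (orbitCoordRep (MvPolynomial.rename toLex (perPoly (Fin m) ℂ)) m) p.1 * highestWeightSpace (orbitCoordRep (MvPolynomial.rename toLex (perPoly (Fin m) ℂ)) m) p.2)) ≠ 0 := by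
  intro m hm χ hne hatom
  -- the decomposable part vanishes at an atom
  have hdec : (⨆ p : Weight (MatIdx m) × Weight (MatIdx m),
      ⨆ (_ : p.1 + p.2 = χ ∧ p.1 ≠ 0 ∧ p.2 ≠ 0),
        highestWeightSpace (orbitCoordRep (MvPolynomial.rename toLex (perPoly (Fin m) ℂ)) m) p.1 *
          highestWeightSpace (orbitCoordRep (MvPolynomial.rename toLex (perPoly (Fin m) ℂ)) m) p.2) = ⊥ := by
    refine iSup_eq_bot.2 fun p => iSup_eq_bot.2 fun hp => ?_
    rcases hatom p.1 p.2 hp.1 hp.2.1 hp.2.2 with h1 | h2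
    · rw [h1, Submodule.bot_mul]
    · rw [h2, Submodule.mul_bot]
  rw [hdec, Submodule.comap_bot, Submodule.ker_subtype]
  -- `HWV_χ ⧸ ⊥ ≅ HWV_χ`, nonzero and finite-dimensional
  haveI := finiteDimensional_highestWeightSpace_orbitCoordRep_holds
    (MvPolynomial.rename toLex (perPoly (Fin m) ℂ)) (m := m) (by omega) χ
  haveI : Nontrivial (highestWeightSpace (orbitCoordRep (MvPolynomial.rename toLex (perPoly (Fin m) ℂ)) m) χ) :=
    Submodule.nontrivial_iff_ne_bot.2 hne
  rw [(Submodule.quotEquivOfEqBot _ rfl).finrank_eq]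
  exact Module.finrank_pos.ne'

end Summit.ValiantsHypothesis.ValiantsHypothesis.Theorems.GeneratorObstructions.PerGenDegreeSuperQP

end
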